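import Summits.AtomisticToContinuum.HydrodynamicLimit.Theorems.LambertianContactSwapLambertianEulerLambertLaw
import Summits.AtomisticToContinuum.HydrodynamicLimit.Theorems.LambertianContactSwapLambertianEulerArchimedes
import HarnessLib

/-!
# The second moment of the Lambert cosine law
# (`LambertianContactSwap.LambertianEuler`, stmt-AtomisticToContinuum-11854, line `Sketch`,
# sub-goal `lambertDir_second_moment` of stub `stub_tailsLambda`)

For a contact normal `ω ≠ 0` of `ℝ³`, `ω̂ = ω/‖ω‖`, and a standard Gaussian vector `ξ`, the
Lambertian direction `n = lambertDir ω ξ = normalize(ω̂ + ξ̂)` satisfies, for every `c ∈ ℝ³`,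

`E[⟪c, n⟫²] = ¼ (‖c‖² + ⟪c, ω̂⟫²)` (`lambertDir_second_moment`),

i.e. the second-moment matrix of the cosine law is `E[n ⊗ n] = ¼ (1 + ω̂ ⊗ ω̂)`.

Proof (rotational symmetry about `ω̂`). The quadratic form `Q(c) = E[⟪c, n⟫²]` is invariant
under every linear isometry `L` of `ℝ³` fixing `ω̂` (`secondMoment_map`: the Gaussian is
`L`-invariant, `ProbabilityTheory.stdGaussian_map`, and `lambertDir` is `L`-equivariant), so by
the parallelogram law `Q(a + b) = Q(a) + Q(b)` whenever a reflection fixing `ω̂` and `a` negates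
`b` (`secondMoment_split`). In the orthonormal frame `(e₁, e₂, ω̂)` of
`DicedHardSphereDynamics.Lambert` this gives
`Q(c) = ⟪c, ω̂⟫² Q(ω̂) + ⟪c, e₁⟫² Q(e₁) + ⟪c, e₂⟫² Q(e₂)` with `Q(e₁) = Q(e₂)` (the reflection
swapping `e₁`, `e₂`); `Q(ω̂) = ½` by the Lambert law
(`…LambertLaw.lambertLaw`) and Archimedes' hat-box theorem (`…Archimedes.archimedesV3`):
`E[⟪ω̂, n⟫²] = ½ ∫_{-1}^{1} 4 t₊ t² dt = ½`; and the trace `Q(e₁) + Q(e₂) + Q(ω̂) = E‖n‖² = 1`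
(`‖n‖ = 1` a.s.) gives `Q(e₁) = Q(e₂) = ¼`. All [folklore].
-/

noncomputable section

open MeasureTheory ProbabilityTheory Set Real Filter
open scoped ENNReal InnerProductSpace

namespace Summit.AtomisticToContinuum.HydrodynamicLimit.Theorems.LambertianContactSwapLambertianEulerSecondMoment

open Literature.MathematicalPhysics.KineticTheory Literature.Analysis.FluidPDE
open Summit.AtomisticToContinuum.HydrodynamicLimit.Theorems.LambertianContactSwapLambertianEulerGaussianFrame
open Summit.AtomisticToContinuum.HydrodynamicLimit.Theorems.LambertianContactSwapLambertianEulerLambertLaw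
open Summit.AtomisticToContinuum.HydrodynamicLimit.Theorems.LambertianContactSwapLambertianEulerArchimedes

/-! ### The quadratic form `Q(c) = E[⟪c, n⟫²]`: integrability, parallelogram law, scaling -/

/-- The squared component `⟪c, lambertDir ω ξ⟫²` is bounded by `‖c‖²` (`‖lambertDir ω ξ‖ ≤ 1`),
hence integrable against the standard Gaussian. [folklore] -/
theorem integrable_inner_lambertDir_sq (ω c : V3) :
    Integrable (fun ξ : V3 => ⟪c, lambertDir ω ξ⟫_ℝ ^ 2) (stdGaussian V3) := by
  have hm : Measurable fun ξ : V3 => ⟪c, lambertDir ω ξ⟫_ℝ ^ 2 :=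
    (measurable_const.inner (measurable_const.lambertDir measurable_id)).pow_const 2
  refine Integrable.of_bound hm.aestronglyMeasurable (‖c‖ ^ 2) (Eventually.of_forall fun ξ => ?_)
  have h : |⟪c, lambertDir ω ξ⟫_ℝ| ≤ ‖c‖ :=
    (abs_real_inner_le_norm c _).trans
      (mul_le_of_le_one_right (norm_nonneg c) (norm_lambertDir_le_one ω ξ))
  rw [Real.norm_eq_abs, abs_pow]
  exact pow_le_pow_left₀ (abs_nonneg _) h 2

/-- **Parallelogram law** of the quadratic form `Q(c) = E[⟪c, n⟫²]`:
`Q(a + b) + Q(a - b) = 2 Q(a) + 2 Q(b)`. [folklore] -/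
theorem secondMoment_add_add_sub (ω a b : V3) :
    ∫ ξ, ⟪a + b, lambertDir ω ξ⟫_ℝ ^ 2 ∂(stdGaussian V3) +
        ∫ ξ, ⟪a - b, lambertDir ω ξ⟫_ℝ ^ 2 ∂(stdGaussian V3) =
      2 * ∫ ξ, ⟪a, lambertDir ω ξ⟫_ℝ ^ 2 ∂(stdGaussian V3) +
        2 * ∫ ξ, ⟪b, lambertDir ω ξ⟫_ℝ ^ 2 ∂(stdGaussian V3) := by
  rw [← integral_add (integrable_inner_lambertDir_sq ω _) (integrable_inner_lambertDir_sq ω _),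
    ← integral_const_mul, ← integral_const_mul,
    ← integral_add ((integrable_inner_lambertDir_sq ω a).const_mul 2)
      ((integrable_inner_lambertDir_sq ω b).const_mul 2)]
  refine integral_congr_ae (Eventually.of_forall fun ξ => ?_)
  simp only [inner_add_left, inner_sub_left]
  ring

/-- Homogeneity of the quadratic form: `Q(s c) = s² Q(c)`. [folklore] -/
theorem secondMoment_smul (ω a : V3) (s : ℝ) :
    ∫ ξ, ⟪s • a, lambertDir ω ξ⟫_ℝ ^ 2 ∂(stdGaussian V3) =
      s ^ 2 * ∫ ξ, ⟪a, lambertDir ω ξ⟫_ℝ ^ 2 ∂(stdGaussian V3) := by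
  rw [← integral_const_mul]
  refine integral_congr_ae (Eventually.of_forall fun ξ => ?_)
  simp only [real_inner_smul_left, mul_pow]

/-! ### Rotational symmetry about the contact normal -/

-- adapted from `HalfAngle.map_lambertDir`
-- (…Theorems.LambertianContactSwapLambertianWellPosedFluxLaw), restated to keep the imports light
/-- Equivariance of the Lambertian direction under linear isometries of `ℝ³`:
`L (lambertDir ω ξ) = lambertDir (L ω) (L ξ)`. [folklore] -/
theorem map_lambertDir_V3 (L : V3 ≃ₗᵢ[ℝ] V3) (ω ξ : V3) :
    L (lambertDir ω ξ) = lambertDir (L ω) (L ξ) := by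
  have hu : ‖ω‖⁻¹ • L ω + ‖ξ‖⁻¹ • L ξ = L (‖ω‖⁻¹ • ω + ‖ξ‖⁻¹ • ξ) := by
    simp only [map_add, map_smul]
  simp only [lambertDir, LinearIsometryEquiv.norm_map]
  rw [hu, LinearIsometryEquiv.norm_map, map_smul]

/-- **Invariance of the quadratic form under isometries fixing the normal**: if `L` is a linear
isometry of `ℝ³` with `L ω = ω` then `Q(L c) = Q(c)` — the Gaussian is `L`-invariant and
`lambertDir ω (L ξ) = L (lambertDir ω ξ)`. [folklore] -/
theorem secondMoment_map {ω : V3} (L : V3 ≃ₗᵢ[ℝ] V3) (hL : L ω = ω) (c : V3) :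
    ∫ ξ, ⟪L c, lambertDir ω ξ⟫_ℝ ^ 2 ∂(stdGaussian V3) =
      ∫ ξ, ⟪c, lambertDir ω ξ⟫_ℝ ^ 2 ∂(stdGaussian V3) := by
  have hmap : (stdGaussian V3).map L = stdGaussian V3 := stdGaussian_map L
  have h := integral_map_equiv (μ := stdGaussian V3) L.toHomeomorph.toMeasurableEquiv
    (fun ξ : V3 => ⟪L c, lambertDir ω ξ⟫_ℝ ^ 2)
  have hcoe : ⇑L.toHomeomorph.toMeasurableEquiv = L := rfl
  rw [hcoe, hmap] at h
  rw [h]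
  refine integral_congr_ae (Eventually.of_forall fun ξ => ?_)
  have hn : lambertDir ω (L ξ) = L (lambertDir ω ξ) := by rw [map_lambertDir_V3, hL]
  simp only [hn, LinearIsometryEquiv.inner_map_map]

/-- **Splitting**: if a linear isometry of `ℝ³` fixes `ω` and `a` and negates `b`, then
`Q(a + b) = Q(a) + Q(b)` (invariance `Q(a + b) = Q(a - b)` and the parallelogram law).
[folklore] -/
theorem secondMoment_split {ω a b : V3} (L : V3 ≃ₗᵢ[ℝ] V3) (hL : L ω = ω) (ha : L a = a)
    (hb : L b = -b) :
    ∫ ξ, ⟪a + b, lambertDir ω ξ⟫_ℝ ^ 2 ∂(stdGaussian V3) =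
      ∫ ξ, ⟪a, lambertDir ω ξ⟫_ℝ ^ 2 ∂(stdGaussian V3) +
        ∫ ξ, ⟪b, lambertDir ω ξ⟫_ℝ ^ 2 ∂(stdGaussian V3) := by
  have h1 : ∫ ξ, ⟪a - b, lambertDir ω ξ⟫_ℝ ^ 2 ∂(stdGaussian V3) =
      ∫ ξ, ⟪a + b, lambertDir ω ξ⟫_ℝ ^ 2 ∂(stdGaussian V3) := by
    rw [← secondMoment_map L hL (a + b), map_add, ha, hb, ← sub_eq_add_neg]
  have h2 := secondMoment_add_add_sub ω a b
  rw [h1] at h2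
  linarith

/-! ### The axial second moment `E[⟪ω̂, n⟫²] = ½` -/

/-- `∫_{-1}^{1} 4 t₊ t² dt = 1`. [folklore] -/
theorem integral_weight_mul_sq : ∫ t in (-1 : ℝ)..1, 4 * max t 0 * t ^ 2 = 1 := by
  have hint : ∀ a b : ℝ, IntervalIntegrable (fun t : ℝ => 4 * max t 0 * t ^ 2) volume a b :=
    fun a b => ((continuous_const.mul (continuous_id.max continuous_const)).mul
      (continuous_pow 2)).intervalIntegrable a b
  have h1 : ∫ t in (-1 : ℝ)..0, 4 * max t 0 * t ^ 2 = 0 := by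
    rw [intervalIntegral.integral_congr (g := fun _ => (0 : ℝ)) fun t ht => ?_]
    · exact intervalIntegral.integral_zero
    · rw [uIcc_of_le (by norm_num)] at ht
      simp only [max_eq_right ht.2, mul_zero, zero_mul]
  have h2 : ∫ t in (0 : ℝ)..1, 4 * max t 0 * t ^ 2 = 1 := by
    rw [intervalIntegral.integral_congr (g := fun t : ℝ => 4 * t ^ 3) fun t ht => ?_]
    · rw [intervalIntegral.integral_const_mul, integral_pow]
      norm_num
    · rw [uIcc_of_le zero_le_one] at ht
      simp only [max_eq_left ht.1]
      ring
  rw [← intervalIntegral.integral_add_adjacent_intervals (hint (-1) 0) (hint 0 1), h1, h2,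
    zero_add]

/-- `½ ∫⁻_{[-1,1]} 4 t₊ · t² dt = ½` in `ℝ≥0∞`: the axial second moment of the cosine law, once
the polar cosine is known to be uniform on `[-1, 1]`. [folklore] -/
theorem lintegral_weight_mul_sq :
    2⁻¹ * ∫⁻ t in Icc (-1 : ℝ) 1, ENNReal.ofReal (4 * max t 0) * ENNReal.ofReal (t ^ 2) =
      2⁻¹ := by
  have hmul : ∀ t : ℝ, ENNReal.ofReal (4 * max t 0) * ENNReal.ofReal (t ^ 2) =
      ENNReal.ofReal (4 * max t 0 * t ^ 2) := fun t => (ENNReal.ofReal_mul (by positivity)).symm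
  have hcont : Continuous fun t : ℝ => 4 * max t 0 * t ^ 2 :=
    (continuous_const.mul (continuous_id.max continuous_const)).mul (continuous_pow 2)
  have hnn : ∀ t ∈ Icc (-1 : ℝ) 1, 0 ≤ 4 * max t 0 * t ^ 2 := fun t _ => by positivity
  simp_rw [hmul]
  rw [← ofReal_integral_eq_lintegral_ofReal hcont.integrableOn_Icc
      (ae_restrict_of_forall_mem measurableSet_Icc hnn), integral_Icc_eq_integral_Ioc,
    ← intervalIntegral.integral_of_le (by norm_num : (-1 : ℝ) ≤ 1), integral_weight_mul_sq,
    ENNReal.ofReal_one, mul_one]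

/-- **The axial second moment of the cosine law**: for a unit normal `ω`,
`E[⟪ω, lambertDir ω ξ⟫²] = ½` — by the Lambert law the left side is `E[4 (⟪ω, ξ̂⟫)₊ ⟪ω, ξ̂⟫²]`,
and `⟪ω, ξ̂⟫` is uniform on `[-1, 1]` (Archimedes), so it equals `½ ∫_0^1 4t³ dt = ½`.
[folklore] -/
theorem secondMoment_self {ω : V3} (hω : ‖ω‖ = 1) :
    ∫ ξ, ⟪ω, lambertDir ω ξ⟫_ℝ ^ 2 ∂(stdGaussian V3) = 2⁻¹ := by
  have hω0 : ω ≠ 0 := fun h => by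
    rw [h, norm_zero] at hω
    exact zero_ne_one hω
  have hω1 : ‖ω‖⁻¹ • ω = ω := by rw [hω, inv_one, one_smul]
  have hF : Measurable fun n : V3 => ENNReal.ofReal (⟪ω, n⟫_ℝ ^ 2) := by fun_prop
  have hm : Measurable fun ξ : V3 => ⟪ω, lambertDir ω ξ⟫_ℝ ^ 2 :=
    (measurable_const.inner (measurable_const.lambertDir measurable_id)).pow_const 2
  have hG : Measurable fun t : ℝ => ENNReal.ofReal (4 * max t 0) * ENNReal.ofReal (t ^ 2) :=
    (ENNReal.measurable_ofReal.comp (measurable_const.mul (measurable_id.max measurable_const))).mul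
      (ENNReal.measurable_ofReal.comp (measurable_id.pow_const 2))
  have hhat : ∀ ξ : V3, ⟪ω, ‖ξ‖⁻¹ • ξ⟫_ℝ = ⟪ω, ξ⟫_ℝ / ‖ξ‖ := fun ξ => by
    rw [real_inner_smul_right, div_eq_inv_mul]
  have key := lambertLaw ω hω0 _ hF
  rw [hω1] at key
  rw [integral_eq_lintegral_of_nonneg_ae (Eventually.of_forall fun ξ => sq_nonneg _)
    hm.aestronglyMeasurable, key]
  simp_rw [hhat]
  rw [archimedesV3 ω hω _ hG, lintegral_weight_mul_sq, ENNReal.toReal_inv, ENNReal.toReal_ofNat]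

/-! ### The trace `E‖n‖² = 1` and the assembly in the adapted frame -/

/-- Parseval in the frame `(e₁ ω, e₂ ω, ω)` of `DicedHardSphereDynamics.Lambert` (unit `ω`):
`⟪e₁ ω, z⟫² + ⟪e₂ ω, z⟫² + ⟪ω, z⟫² = ‖z‖²`. [folklore] -/
theorem sum_sq_inner_frame {ω : V3} (hω : ‖ω‖ = 1) (z : V3) :
    ⟪Lambert.e₁ ω, z⟫_ℝ ^ 2 + ⟪Lambert.e₂ ω, z⟫_ℝ ^ 2 + ⟪ω, z⟫_ℝ ^ 2 = ‖z‖ ^ 2 := by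
  have h := (Lambert.frameBasis hω).sum_sq_inner_right z
  rw [Lambert.coe_frameBasis, Fin.sum_univ_three] at h
  simpa [Lambert.frame] using h

/-- **Trace identity**: `Q(e₁ ω) + Q(e₂ ω) + Q(ω) = E‖lambertDir ω ξ‖² = 1` for a unit normal `ω`
(`‖lambertDir ω ξ‖ = 1` almost surely). [folklore] -/
theorem secondMoment_trace {ω : V3} (hω : ‖ω‖ = 1) :
    ∫ ξ, ⟪Lambert.e₁ ω, lambertDir ω ξ⟫_ℝ ^ 2 ∂(stdGaussian V3) +
        ∫ ξ, ⟪Lambert.e₂ ω, lambertDir ω ξ⟫_ℝ ^ 2 ∂(stdGaussian V3) +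
        ∫ ξ, ⟪ω, lambertDir ω ξ⟫_ℝ ^ 2 ∂(stdGaussian V3) = 1 := by
  have hsum : Integrable (fun ξ : V3 => ⟪Lambert.e₁ ω, lambertDir ω ξ⟫_ℝ ^ 2 +
      ⟪Lambert.e₂ ω, lambertDir ω ξ⟫_ℝ ^ 2) (stdGaussian V3) :=
    (integrable_inner_lambertDir_sq ω _).add (integrable_inner_lambertDir_sq ω _)
  rw [← integral_add (integrable_inner_lambertDir_sq ω _) (integrable_inner_lambertDir_sq ω _),
    ← integral_add hsum (integrable_inner_lambertDir_sq ω _)]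
  simp_rw [sum_sq_inner_frame hω]
  have hae : (fun ξ : V3 => ‖lambertDir ω ξ‖ ^ 2) =ᵐ[stdGaussian V3] fun _ => (1 : ℝ) := by
    filter_upwards [ae_stdGaussian_lambertDir_ne_zero_euclideanSpace ω] with ξ h
    rw [norm_lambertDir h, one_pow]
  rw [integral_congr_ae hae, integral_const, smul_eq_mul, mul_one, probReal_univ]

/-- **The second moment of the cosine law, unit normal**: for `‖ω‖ = 1` and every `c`,
`E[⟪c, lambertDir ω ξ⟫²] = ¼ (‖c‖² + ⟪c, ω⟫²)`. Decompose `c = ⟪c, ω⟫ ω + ⟪e₁, c⟫ e₁ + ⟪e₂, c⟫ e₂`,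
split `Q` along the reflections negating `e₁`, resp. `e₂` (both fix `ω`), identify
`Q(e₁) = Q(e₂)` by the reflection swapping them, and use `Q(ω) = ½`, `Q(e₁) + Q(e₂) + Q(ω) = 1`.
[folklore] -/
theorem secondMoment_unit {ω : V3} (hω : ‖ω‖ = 1) (c : V3) :
    ∫ ξ, ⟪c, lambertDir ω ξ⟫_ℝ ^ 2 ∂(stdGaussian V3) = 4⁻¹ * (‖c‖ ^ 2 + ⟪c, ω⟫_ℝ ^ 2) := by
  -- the frame
  have h11 : ‖Lambert.e₁ ω‖ = 1 := Lambert.norm_e₁ ω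
  have h22 : ‖Lambert.e₂ ω‖ = 1 := Lambert.norm_e₂ hω
  have h12 : ⟪Lambert.e₁ ω, Lambert.e₂ ω⟫_ℝ = 0 := Lambert.inner_e₁_e₂ ω
  have h21 : ⟪Lambert.e₂ ω, Lambert.e₁ ω⟫_ℝ = 0 := Lambert.inner_e₂_e₁ ω
  have h1ω : ⟪Lambert.e₁ ω, ω⟫_ℝ = 0 := Lambert.inner_e₁_self ω
  have h2ω : ⟪Lambert.e₂ ω, ω⟫_ℝ = 0 := Lambert.inner_e₂_self ω
  -- the three reflections fixing `ω`: negate `e₁`, negate `e₂`, swap `e₁` and `e₂`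
  set R₁ : V3 ≃ₗᵢ[ℝ] V3 := (ℝ ∙ Lambert.e₁ ω)ᗮ.reflection with hR₁
  set R₂ : V3 ≃ₗᵢ[ℝ] V3 := (ℝ ∙ Lambert.e₂ ω)ᗮ.reflection with hR₂
  set R₃ : V3 ≃ₗᵢ[ℝ] V3 := (ℝ ∙ (Lambert.e₁ ω - Lambert.e₂ ω))ᗮ.reflection with hR₃
  have hR₁ω : R₁ ω = ω := Submodule.reflection_mem_subspace_eq_self
    (Submodule.mem_orthogonal_singleton_iff_inner_right.2 h1ω)
  have hR₁e₂ : R₁ (Lambert.e₂ ω) = Lambert.e₂ ω := Submodule.reflection_mem_subspace_eq_self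
    (Submodule.mem_orthogonal_singleton_iff_inner_right.2 h12)
  have hR₁e₁ : R₁ (Lambert.e₁ ω) = -Lambert.e₁ ω :=
    Submodule.reflection_orthogonalComplement_singleton_eq_neg _
  have hR₂ω : R₂ ω = ω := Submodule.reflection_mem_subspace_eq_self
    (Submodule.mem_orthogonal_singleton_iff_inner_right.2 h2ω)
  have hR₂e₂ : R₂ (Lambert.e₂ ω) = -Lambert.e₂ ω :=
    Submodule.reflection_orthogonalComplement_singleton_eq_neg _
  have hR₃ω : R₃ ω = ω := Submodule.reflection_mem_subspace_eq_self
    (Submodule.mem_orthogonal_singleton_iff_inner_right.2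
      (by rw [inner_sub_left, h1ω, h2ω, sub_zero]))
  have hR₃e₁ : R₃ (Lambert.e₁ ω) = Lambert.e₂ ω := Submodule.reflection_sub (by rw [h11, h22])
  -- the values on the frame: `Q ω = ½`, `Q e₁ = Q e₂ = ¼`
  have hQω := secondMoment_self hω
  have hQ12 : ∫ ξ, ⟪Lambert.e₂ ω, lambertDir ω ξ⟫_ℝ ^ 2 ∂(stdGaussian V3) =
      ∫ ξ, ⟪Lambert.e₁ ω, lambertDir ω ξ⟫_ℝ ^ 2 ∂(stdGaussian V3) := by
    rw [← hR₃e₁, secondMoment_map R₃ hR₃ω]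
  have htr := secondMoment_trace hω
  rw [hQ12, hQω] at htr
  have hQ1 : ∫ ξ, ⟪Lambert.e₁ ω, lambertDir ω ξ⟫_ℝ ^ 2 ∂(stdGaussian V3) = 4⁻¹ := by linarith
  -- decomposition of `c` and splitting
  have hc : c = (⟪c, ω⟫_ℝ • ω + ⟪Lambert.e₂ ω, c⟫_ℝ • Lambert.e₂ ω) +
      ⟪Lambert.e₁ ω, c⟫_ℝ • Lambert.e₁ ω := by
    have h := proj_eq_frame hω c
    rw [sub_eq_iff_eq_add] at h
    exact h.trans (by abel)
  have hsplit₁ := secondMoment_split (ω := ω)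
    (a := ⟪c, ω⟫_ℝ • ω + ⟪Lambert.e₂ ω, c⟫_ℝ • Lambert.e₂ ω)
    (b := ⟪Lambert.e₁ ω, c⟫_ℝ • Lambert.e₁ ω) R₁ hR₁ω
    (by rw [map_add, map_smul, map_smul, hR₁ω, hR₁e₂]) (by rw [map_smul, hR₁e₁, smul_neg])
  have hsplit₂ := secondMoment_split (ω := ω) (a := ⟪c, ω⟫_ℝ • ω)
    (b := ⟪Lambert.e₂ ω, c⟫_ℝ • Lambert.e₂ ω) R₂ hR₂ω
    (by rw [map_smul, hR₂ω]) (by rw [map_smul, hR₂e₂, smul_neg])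
  rw [hsplit₂, secondMoment_smul, secondMoment_smul, secondMoment_smul, hQω, hQ12, hQ1] at hsplit₁
  -- Parseval for `c`
  have hpars := sum_sq_inner_frame hω c
  rw [real_inner_comm c ω] at hpars
  rw [← hc] at hsplit₁
  rw [hsplit₁]
  linarith

/-! ### The registered sub-goal -/

/-- **Second moment of the Lambert cosine law** (registered sub-goal `lambertDir_second_moment`
of stub `stub_tailsLambda`, line `Sketch`, crux stmt-AtomisticToContinuum-11854): for a contact
normal `ω ≠ 0` with `ω̂ = ω/‖ω‖`, a standard Gaussian `ξ` of `ℝ³` and every `c ∈ ℝ³`,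
`E[⟪c, lambertDir ω ξ⟫²] = ¼ (‖c‖² + ⟪c, ω̂⟫²)` — the second-moment matrix of the cosine law
`4 (n·ω̂)₊ dσ(n)/(4π)` on the outgoing hemisphere is `¼ (1 + ω̂ ⊗ ω̂)` (axial part `½` from
`∫_0^1 4t³ dt`, tangential part `¼` per direction by the trace and rotational symmetry).
[folklore] -/
theorem lambertDir_second_moment :
    ∀ ω : V3, ω ≠ 0 → ∀ c : V3,
      ∫ ξ, ⟪c, lambertDir ω ξ⟫_ℝ ^ 2 ∂(stdGaussian V3) = 4⁻¹ * (‖c‖ ^ 2 + ⟪c, ‖ω‖⁻¹ • ω⟫_ℝ ^ 2) := by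
  intro ω hω c
  have hn : ‖ω‖ ≠ 0 := norm_ne_zero_iff.2 hω
  have hunit : ‖‖ω‖⁻¹ • ω‖ = 1 := by rw [norm_smul, norm_inv, norm_norm, inv_mul_cancel₀ hn]
  have hdir : ∀ ξ, lambertDir ω ξ = lambertDir (‖ω‖⁻¹ • ω) ξ := fun ξ =>
    (lambertDir_smul_left (inv_pos.2 (norm_pos_iff.2 hω)) ω ξ).symm
  simp_rw [hdir]
  exact secondMoment_unit hunit c

end Summit.AtomisticToContinuum.HydrodynamicLimit.Theorems.LambertianContactSwapLambertianEulerSecondMoment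

end
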